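import Literature.Probability.LatticeModels.FreeBoundaryReflectionPositivity
import Literature.Probability.LatticeModels.CriticalCorrWellDefined
import Summits.CriticalPhenomena.Ising3DConformalLimit.Theses.HyperoctahedralRP
import HarnessLib

/-!
# Site-mirror reflection positivity of the critical `ℤ³` Ising correlators: stub `stub_latticeRP`
# of line `free-endpoint-gaussian-closure` for crux `InversionUpgradeNormalised`
# (stmt-CriticalPhenomena-1982)

Statement.  Fix a coordinate `τ : Fin 3` and let `θ_τ : ℤ³ → ℤ³` negate the `τ`-th coordinate
(the reflection in the lattice plane `{k_τ = 0}`, which it fixes pointwise).  For finitely many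
lattice configurations `z^a : Fin (k a) → ℤ³` lying in the CLOSED half-lattice `{k_τ ≥ 0}` and real
coefficients `c_a`,
`0 ≤ Σ_{a,b} c_a c_b ⟨∏ᵢ σ_{θ_τ z^a_i} ∏ⱼ σ_{z^b_j}⟩_{β_c}`,
the correlators being the critical infinite-volume ones `criticalCorr 3` (spin monomials,
multiplicities allowed, the two monomials concatenated by `Fin.append`).

Proof (Fröhlich–Israel–Lieb–Simon 1978 §2, reflection positivity "through sites";
Friedli–Velenik 2017 Lemma 10.8 / Example 10.9).
* `θ_τ` is an involutive automorphism of the nearest-neighbour graph `zdGraph d`, the centred boxes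
  `box d L` are `θ_τ`-stable, and the half `P = {k_τ ≥ 0}` is in the FILS site position:
  `ℤ^d = P ∪ θ_τ P`, `θ_τ = id` on `P ∩ θ_τ P = {k_τ = 0}`, and every edge lies in `P` or in `θ_τ P`
  (an edge changes one coordinate by `±1`, so an edge leaving `P` joins `k_τ = 0` to `k_τ = -1`).
* `F := Σ_a c_a ∏ᵢ σ_{z^a_i}` is bounded, measurable and depends only on the spins in `P`, and
  `(F ∘ θ_τ^*) · F = Σ_{a,b} c_a c_b ∏ σ_{θ_τ z^a ++ z^b}`; hence, by the tree theorem
  `isingExpect_free_reflect_mul_self_nonneg` (free finite volumes are reflection positive through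
  sites) and linearity of the finite-volume expectation,
  `0 ≤ Σ_{a,b} c_a c_b ⟨∏ σ_{θ_τ z^a ++ z^b}⟩^∅_{box d L; β, h}` for every `L`, `β`, `h`.
* At `d = 3`, `β = β_c`, `h = 0` every free box expectation of a spin monomial converges to the
  critical correlator (`criticalCorr_wellDefined_holds`, which rests on `m*(β_c) = 0`,
  Aizenman–Duminil-Copin–Sidoravicius 2015), and the inequality passes to the limit `L → ∞`.

References: J. Fröhlich, R. Israel, E. H. Lieb, B. Simon, Comm. Math. Phys. 62 (1978) 1–34, §2;
S. Friedli, Y. Velenik, *Statistical Mechanics of Lattice Systems* (CUP 2017), Lemma 10.8,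
Example 10.9, Thm. 3.17.
-/

noncomputable section

open Filter Topology MeasureTheory
open Literature.Probability.LatticeModels

namespace Summit.CriticalPhenomena.Ising3DConformalLimit.Cruxes.InversionUpgradeNormalised.FreeEndpointGaussianClosure

variable {d : ℕ}

/-! ### The coordinate mirror `θ_τ : x ↦ (x with x_τ ↦ -x_τ)` of `ℤ^d` -/

/-- The coordinate mirror `θ_τ x = Function.update x τ (-x τ)` is an involution of `ℤ^d`
(FILS 1978 §2, reflection through the sites of the plane `{x_τ = 0}`). -/
theorem mirror_involutive (τ : Fin d) :
    Function.Involutive (fun x : Site d => Function.update x τ (-x τ)) := by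
  intro x
  funext j
  by_cases hj : j = τ
  · subst hj; simp
  · simp [Function.update_of_ne hj]

/-- `θ_τ (x + e_τ) = θ_τ x - e_τ`: a forward step across the mirror is reflected into a backward
one. -/
theorem mirror_add_single_self (τ : Fin d) (x : Site d) :
    Function.update (x + Pi.single τ 1) τ (-(x + Pi.single τ 1 : Site d) τ) =
      Function.update x τ (-x τ) - Pi.single τ 1 := by
  funext j
  by_cases hj : j = τ
  · subst hj
    simp only [Function.update_self, Pi.add_apply, Pi.sub_apply, Pi.single_eq_same]
    ring
  · simp [Function.update_of_ne hj, Pi.single_eq_of_ne hj]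

/-- `θ_τ (x + e_i) = θ_τ x + e_i` for a direction `i ≠ τ` parallel to the mirror. -/
theorem mirror_add_single_of_ne {τ i : Fin d} (hi : i ≠ τ) (x : Site d) :
    Function.update (x + Pi.single i 1) τ (-(x + Pi.single i 1 : Site d) τ) =
      Function.update x τ (-x τ) + Pi.single i 1 := by
  funext j
  by_cases hj : j = τ
  · subst hj
    simp [Pi.single_eq_of_ne (Ne.symm hi)]
  · simp [Function.update_of_ne hj]

/-- The coordinate mirror is an automorphism of the nearest-neighbour graph of `ℤ^d`
(it is a signed coordinate permutation; FILS 1978 §2). -/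
theorem mirror_adj (τ : Fin d) {x y : Site d} (h : (zdGraph d).Adj x y) :
    (zdGraph d).Adj (Function.update x τ (-x τ)) (Function.update y τ (-y τ)) := by
  rw [zdGraph_adj_iff] at h ⊢
  obtain ⟨i, hi⟩ := h
  refine ⟨i, ?_⟩
  by_cases hiτ : i = τ
  · subst hiτ
    rcases hi with rfl | rfl
    · exact Or.inr (by rw [mirror_add_single_self, sub_add_cancel])
    · exact Or.inl (by rw [mirror_add_single_self, sub_add_cancel])
  · rcases hi with rfl | rfl
    · exact Or.inl (mirror_add_single_of_ne hiτ x)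
    · exact Or.inr (mirror_add_single_of_ne hiτ y)

/-- The mirror image of a point of the centred box `{-L,…,L}^d` lies in the box. -/
theorem mirror_mem_box (τ : Fin d) {L : ℕ} {x : Site d} (hx : x ∈ box d L) :
    Function.update x τ (-x τ) ∈ box d L := by
  rw [mem_box] at hx ⊢
  intro j
  by_cases hj : j = τ
  · subst hj
    have h := hx j
    rw [Function.update_self]
    omega
  · rw [Function.update_of_ne hj]
    exact hx j

/-- The centred boxes are mirror-stable: `x ∈ box d L ↔ θ_τ x ∈ box d L`. -/
theorem mem_box_iff_mirror_mem_box (τ : Fin d) (L : ℕ) (x : Site d) :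
    x ∈ box d L ↔ Function.update x τ (-x τ) ∈ box d L := by
  refine ⟨mirror_mem_box τ, fun h => ?_⟩
  have h2 : Function.update (Function.update x τ (-x τ)) τ (-Function.update x τ (-x τ) τ) = x :=
    mirror_involutive τ x
  have h' := mirror_mem_box τ h
  rwa [h2] at h'

/-- Along an edge of `ℤ^d` every coordinate changes by at most one. -/
theorem apply_le_add_one_of_adj (τ : Fin d) {x y : Site d} (h : (zdGraph d).Adj x y) :
    x τ ≤ y τ + 1 ∧ y τ ≤ x τ + 1 := by
  rw [zdGraph_adj_iff] at h
  obtain ⟨i, hi⟩ := h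
  have h01 : (Pi.single i (1 : ℤ) : Site d) τ = 0 ∨ (Pi.single i (1 : ℤ) : Site d) τ = 1 := by
    by_cases hτ : τ = i
    · subst hτ; exact Or.inr (Pi.single_eq_same _ _)
    · exact Or.inl (Pi.single_eq_of_ne hτ _)
  rcases hi with rfl | rfl
  · simp only [Pi.add_apply]; omega
  · simp only [Pi.add_apply]; omega

/-! ### Spin monomials: elementary facts -/

/-- A spin monomial is integrable against any finite measure on configurations. -/
theorem integrable_spinMonomial_aux {V : Type*} (μ : Measure (SpinConfig V)) [IsFiniteMeasure μ]
    {n : ℕ} (x : Fin n → V) : Integrable (spinMonomial x) μ := by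
  classical
  obtain ⟨A, hA⟩ := exists_spinMonomial_eq_spinProduct x
  rw [hA]
  exact integrable_spinProduct μ A

/-- The spin monomial of a concatenated configuration is the product of the two spin monomials
(`Fin.prod_univ_add`). -/
theorem spinMonomial_append_apply {V : Type*} {m n : ℕ} (u : Fin m → V) (v : Fin n → V)
    (s : SpinConfig V) :
    spinMonomial (Fin.append u v) s = spinMonomial u s * spinMonomial v s := by
  simp only [spinMonomial]
  rw [Fin.prod_univ_add]
  simp only [Fin.append_left, Fin.append_right]

/-- Linearity of the finite-volume Gibbs expectation on a double finite combination of spin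
monomials (the integral of a finite sum of integrable functions). -/
theorem isingExpect_sum_sum_mul_spinMonomial {ι : Type*} [Fintype ι] (Λ : Finset (Site d))
    (β h : ℝ) (bc : BoundaryCondition (Site d)) (c : ι → ι → ℝ) {n : ι → ι → ℕ}
    (w : (a b : ι) → Fin (n a b) → Site d) :
    isingExpect (zdGraph d) Λ β h bc (fun σ => ∑ a, ∑ b, c a b * spinMonomial (w a b) σ) =
      ∑ a, ∑ b, c a b * isingExpect (zdGraph d) Λ β h bc (spinMonomial (w a b)) := by
  unfold isingExpect
  rw [integral_finsetSum _ fun a _ => integrable_finsetSum _ fun b _ =>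
    (integrable_spinMonomial_aux _ (w a b)).const_mul (c a b)]
  refine Finset.sum_congr rfl fun a _ => ?_
  rw [integral_finsetSum _ fun b _ => (integrable_spinMonomial_aux _ (w a b)).const_mul (c a b)]
  refine Finset.sum_congr rfl fun b _ => ?_
  exact integral_const_mul _ _

/-! ### Reflection positivity of the free finite volumes through the coordinate planes -/

/-- **Finite-volume site-mirror reflection positivity for combinations of spin monomials.**
For a mirror-stable finite volume `Λ ⊆ ℤ^d`, real `β, h`, configurations `z^a` in the closed
half-lattice `{k_τ ≥ 0}` and real coefficients `c_a`,
`0 ≤ Σ_{a,b} c_a c_b ⟨∏ σ_{θ_τ z^a ++ z^b}⟩^∅_{Λ;β,h}`: the tree theorem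
`isingExpect_free_reflect_mul_self_nonneg` (FILS 1978 §2; Friedli–Velenik 2017 Lemma 10.8 /
Example 10.9) applied to `F = Σ_a c_a ∏ᵢ σ_{z^a_i}` and the half `P = {k_τ ≥ 0}`, followed by the
expansion `(F ∘ θ_τ^*) F = Σ_{a,b} c_a c_b ∏ σ_{θ_τ z^a ++ z^b}` and linearity. -/
theorem sum_sum_mul_isingExpect_free_mirror_nonneg (τ : Fin d) {Λ : Finset (Site d)}
    (hΛ : ∀ x, x ∈ Λ ↔ Function.update x τ (-x τ) ∈ Λ) (β h : ℝ) {m : ℕ} (k : Fin m → ℕ)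
    (z : (a : Fin m) → Fin (k a) → Site d) (c : Fin m → ℝ) (hz : ∀ a i, 0 ≤ z a i τ) :
    0 ≤ ∑ a, ∑ b, c a * c b * isingExpect (zdGraph d) Λ β h .free
      (spinMonomial (Fin.append (fun i => Function.update (z a i) τ (-(z a i τ))) (z b))) := by
  classical
  -- the mirror as an `Equiv`, and the closed half-lattice
  let θ : Site d ≃ Site d := (mirror_involutive τ).toPerm _
  have hθ : ∀ x, θ x = Function.update x τ (-x τ) := fun x => rfl
  let P : Set (Site d) := {x | 0 ≤ x τ}
  have hmemP : ∀ x, x ∈ P ↔ 0 ≤ x τ := fun x => Iff.rfl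
  have hmemθP : ∀ x, θ x ∈ P ↔ 0 ≤ -x τ := fun x => by
    rw [hmemP, hθ, Function.update_self]
  have hθG : ∀ x y, (zdGraph d).Adj x y → (zdGraph d).Adj (θ x) (θ y) :=
    fun x y hxy => mirror_adj τ hxy
  have hΛ' : ∀ x, x ∈ Λ ↔ θ x ∈ Λ := hΛ
  have H1 : ∀ x, x ∈ P ∨ θ x ∈ P := fun x => by
    rw [hmemP, hmemθP]
    omega
  have H2 : ∀ x ∈ P, θ x ∈ P → θ x = x := fun x hx hθx => by
    rw [hmemP] at hx
    rw [hmemθP] at hθx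
    have h0 : x τ = 0 := le_antisymm (by omega) hx
    rw [hθ, h0, neg_zero, ← h0, Function.update_eq_self]
  have H3 : ∀ x y, (zdGraph d).Adj x y → (x ∈ P ∧ y ∈ P) ∨ (θ x ∈ P ∧ θ y ∈ P) :=
    fun x y hxy => by
      have h := apply_le_add_one_of_adj τ hxy
      rw [hmemP, hmemP, hmemθP, hmemθP]
      omega
  -- the observable `F = Σ_a c_a ∏ᵢ σ_{z^a_i}`
  have hFm : Measurable fun σ : SpinConfig (Site d) => ∑ a, c a * spinMonomial (z a) σ :=
    Finset.measurable_sum _ fun a _ => (measurable_spinMonomial (z a)).const_mul (c a)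
  have hFP : DependsOn (fun σ : SpinConfig (Site d) => ∑ a, c a * spinMonomial (z a) σ) P := by
    intro σ σ' hσ
    refine Finset.sum_congr rfl fun a _ => ?_
    simp only [spinMonomial, spinAt]
    congr 1
    exact Finset.prod_congr rfl fun i _ => by rw [hσ (z a i) ((hmemP _).2 (hz a i))]
  have hFb : ∃ C, ∀ σ : SpinConfig (Site d), |∑ a, c a * spinMonomial (z a) σ| ≤ C := by
    refine ⟨∑ a, |c a|, fun σ => (Finset.abs_sum_le_sum_abs _ _).trans (Finset.sum_le_sum
      fun a _ => ?_)⟩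
    -- `|∏ᵢ σ_{z^a_i}| ≤ 1`: the monomial is the spin product of its odd-multiplicity sites
    obtain ⟨A, hA⟩ := exists_spinMonomial_eq_spinProduct (z a)
    rw [abs_mul, hA]
    exact mul_le_of_le_one_right (abs_nonneg _) (abs_spinProduct_le_one A σ)
  -- reflection positivity of the free volume `Λ`
  have hpos := isingExpect_free_reflect_mul_self_nonneg (zdGraph d) θ (mirror_involutive τ) hθG
    hΛ' H1 H2 H3 β h hFm hFP hFb
  -- expansion of `(F ∘ θ^*) F` and linearity
  have hexp : (fun σ : SpinConfig (Site d) => (∑ a, c a * spinMonomial (z a) (configReflect θ σ)) *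
      ∑ a, c a * spinMonomial (z a) σ) = fun σ => ∑ a, ∑ b, c a * c b *
        spinMonomial (Fin.append (fun i => Function.update (z a i) τ (-(z a i τ))) (z b)) σ := by
    funext σ
    rw [Fintype.sum_mul_sum]
    refine Finset.sum_congr rfl fun a _ => Finset.sum_congr rfl fun b _ => ?_
    have hrefl : spinMonomial (z a) (configReflect θ σ) =
        spinMonomial (fun i => Function.update (z a i) τ (-(z a i τ))) σ := rfl
    rw [spinMonomial_append_apply, hrefl]
    ring
  rw [hexp, isingExpect_sum_sum_mul_spinMonomial Λ β h .free (fun a b => c a * c b)] at hpos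
  exact hpos

/-! ### The registered stub -/

/-- **stub_latticeRP** (site-mirror reflection positivity of the critical `ℤ³` correlators).
For every coordinate `τ : Fin 3`, finitely many lattice configurations `z^a` in the closed
half-lattice `{k_τ ≥ 0}` and real coefficients `c_a`,
`0 ≤ Σ_{a,b} c_a c_b ⟨∏ σ_{θ_τ z^a ++ z^b}⟩_{β_c}` with `θ_τ` the negation of the `τ`-th coordinate:
finite-volume free reflection positivity through sites
(`sum_sum_mul_isingExpect_free_mirror_nonneg`, FILS 1978 §2 / Friedli–Velenik 2017 Lemma 10.8) on
the mirror-stable boxes `box 3 L` at `β = β_c`, `h = 0`, and the box limit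
`⟨∏ σ⟩^∅_{box 3 L; β_c, 0} → criticalCorr 3` of every spin monomial
(`criticalCorr_wellDefined_holds`), `ge_of_tendsto'`. -/
theorem stub_latticeRP :
    ∀ (τ : Fin 3) (m : ℕ) (k : Fin m → ℕ) (z : (a : Fin m) → Fin (k a) → Site 3) (c : Fin m → ℝ),
      (∀ a i, 0 ≤ z a i τ) →
      0 ≤ ∑ a, ∑ b, c a * c b *
        criticalCorr 3 (k a + k b)
          (Fin.append (fun i => Function.update (z a i) τ (-(z a i τ))) (z b)) := by
  intro τ m k z c hz
  have hmem : (BoundaryCondition.free : BoundaryCondition (Site 3)) ∈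
      ({.free, .plus, .minus} : Set (BoundaryCondition (Site 3))) := by simp
  have hT : Tendsto (fun L : ℕ => ∑ a, ∑ b, c a * c b *
      isingExpect (zdGraph 3) (box 3 L) (criticalBeta 3) 0 .free
        (spinMonomial (Fin.append (fun i => Function.update (z a i) τ (-(z a i τ))) (z b))))
      atTop (𝓝 (∑ a, ∑ b, c a * c b * criticalCorr 3 (k a + k b)
        (Fin.append (fun i => Function.update (z a i) τ (-(z a i τ))) (z b)))) :=
    tendsto_finsetSum _ fun a _ => tendsto_finsetSum _ fun b _ =>
      (criticalCorr_wellDefined_holds (d := 3) (by norm_num) (k a + k b) _ .free hmem).const_mul _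
  exact ge_of_tendsto' hT fun L => sum_sum_mul_isingExpect_free_mirror_nonneg τ
    (fun x => mem_box_iff_mirror_mem_box τ L x) (criticalBeta 3) 0 k z c hz

end Summit.CriticalPhenomena.Ising3DConformalLimit.Cruxes.InversionUpgradeNormalised.FreeEndpointGaussianClosure

end
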